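import Summits.QuantumFields.BalabanUV.Beta.EriceFlowEnclosureB12AsPrintedLastVar

/-!
# Beta / EriceFlowEnclosureB12AsPrintedLastVarEnd — row I1's necessity witness at the level of the as-printed interface of [I], part 2:
# the runs, the toy setting, and the headlines «[I] as printed is consistent with the failure of every k-uniform last-variable letter» ∕
# «the k-uniform clause is independent of the printed content as typed» (β-flow team, prover 1, unit `b2b-balaban-beta-bflow-p1`, gen 32;
# ROW AP-I; PART 1 = `…B12AsPrintedLastVar`)

HONEST FRAMING (page 1 of everything the β sub-cell writes): discharging `BetaPertH` makes Bałaban's UV stability UNCONDITIONAL — a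
real constructive-QFT result; it is NOT the continuum limit and NOT the Clay problem.  HONEST DEPENDENCY (cell reorg 2026-08-19,
verbatim): «continuum YM on T⁴ ⇐ BetaPertH ∧ nine spine estimates (0/9 proved); BetaPertH ⇐ (D1) ∧ (D4) ∧ CAP+tail; G-an2-4 gates
asym, D1 and NE2/3/4.»  THIS MODULE DISCHARGES NOTHING: it builds ONE toy setting of `B12BetaAsPrinted` ([Balaban1987RG1] as typed,
p537882 ✓ ∕ v1.1 p539116 ✓) inside an existence proof (def-free) — β_{k+1}(g₀, …, g_k) := 1∕100 + 1∕100·φ(k·g_k), Π_{k+1} := β_{k+1}·Re Qᵀ,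
runs = forward solutions of (0.20) — and reads off what the typed predicate does not decide.  The toy is OURS; nothing of Bałaban's
objects is asserted; row I1's clause remains the cell's located HYPOTHESIS for the construction (asserted in print p. 264 under the uniform
reading, unproved there; [Balaban1989LargeFieldII] p. 355).

WHAT THIS FILE PROVES (0 sorry, 0 def):
§3 UNDER THE DEFINING HYPOTHESIS `hcpl` (the coupling table is the forward solution of (0.20) with the toy β): `run_succ_of_hcpl`,
   `run_step_of_hcpl` (= the printed forward determination `d020`), **`run_bound_of_hcpl`** (from 1∕g₀² = 1 + (3∕200)(j + 2): g_k > 0 and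
   1∕g_k² ≥ 1 + (3∕200)(j + 2 − k) for k ≤ j + 1), **`runHyp_of_toy`** (Theorem 3's run hypothesis `RunHyp S (j + 1, 0, g₀(j))` for EVERY j:
   the setting has runs print speaks of at every depth).
§4 **`toyLastVar_exists`** (∃ S with the defining hypotheses, γ = 1, cut-off flag off, `StandingHypotheses ∧ Definitions ∧ Conclusions` —
   (1.22) both members, (5.6)–(5.8), (5.10), (5.37)∕(5.38) with (5.44) by the kernel toolkit of `…B12AsPrintedWitness` at c := β_{k+1}(…));
   **`asPrinted_consistent_with_nonuniform_lastVar`** (∃ S hH, Definitions ∧ Conclusions ∧ B12BetaAsPrinted ∧ BetaSmoothInLast264 ∧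
   BetaDerivsBoundedInLast264 ∧ (∀ j, ∃ P, RunHyp S P ∧ K = j + 1) ∧ (∀ C, ¬LastVarLipschitz S.β C γ) ∧ (∀ C, ¬LastVarLipschitzAtZero S.β C γ) ∧
   ¬∃ C uniform along the runs); **`lastVarLipschitz_independent_of_asPrinted`** (neither «… → ∃ C, LastVarLipschitz» nor «… → ∀ C, ¬…» holds
   for all settings with StandingHypotheses ∧ Definitions ∧ Conclusions: the AF toy of `…Witness` has the constant 0).  READING (ours, said
   once): the ENCLOSURE-MAP's sentence «what remains OUTSIDE print is exactly the step-uniformity of [I] p. 264's clause» now has a kernel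
   witness against the statement-exact typing of [I] itself, not only against the Erice records.
NOT CLAIMED: anything about Bałaban's β; `BetaPertH`; continuum; Clay.
-/

namespace Summit.QuantumFields.BalabanUV.Beta.EriceFlowEnclosureB12AsPrintedLastVarEnd

open Literature.MathematicalPhysics.QuantumFieldTheory.GawedzkiKupiainen1985.PeriodicGleason (Pt delta unitVec ExpBound wt wt_pos)
open Literature.MathematicalPhysics.QuantumFieldTheory.Balaban1983to89
open Literature.MathematicalPhysics.QuantumFieldTheory.Balaban1983to89.B12Rep537 (wilsonQ MQ)
open Literature.MathematicalPhysics.QuantumFieldTheory.Balaban1983to89.B12BetaAsPrinted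
open Literature.MathematicalPhysics.QuantumFieldTheory.Balaban1983to89.FlowStep (prefixOf Box BetaContH BetaLowerH BetaUpperH)
open Literature.MathematicalPhysics.QuantumFieldTheory.Balaban1983to89.BetaDerivClause (LastVarLipschitz LastVarLipschitzAtZero)
open Literature.MathematicalPhysics.QuantumFieldTheory.Balaban1983to89.B12CouplingClausesHistory (BetaSmoothInLast264
  BetaDerivsBoundedInLast264)
open Summit.QuantumFields.BalabanUV.Beta.EriceFlowEnclosureB12AsPrintedMarginal
open Summit.QuantumFields.BalabanUV.Beta.EriceFlowEnclosureB12AsPrintedWitness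

open Summit.QuantumFields.BalabanUV.Beta.EriceFlowEnclosureB12AsPrintedLastVar

noncomputable section

variable {S : Setting}


/-! ## §3 The runs of such a setting: forward solutions of (0.20) from a j-dependent bare coupling reach step j + 1 inside ]0, 1] -/

/-- The forward step of the coupling table under the defining hypothesis (the `Nat.rec` of `…Witness.natRec_run_succ` with the toy β).
[cite: Balaban1987RG1, (0.20) p.256] -/
theorem run_succ_of_hcpl
    (hcpl : ∀ (P : B12.RunParams) (k : ℕ), S.cpl P k = Nat.rec (motive := fun _ => ℝ) P.g0
      (fun k g => 1 / Real.sqrt (1 / g ^ 2 - (1 / 100 + 1 / 100 * ((k : ℝ) * g / (1 + ((k : ℝ) * g) ^ 2))))) k)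
    (P : B12.RunParams) (k : ℕ) :
    S.cpl P (k + 1) = 1 / Real.sqrt (1 / (S.cpl P k) ^ 2 -
      (1 / 100 + 1 / 100 * ((k : ℝ) * S.cpl P k / (1 + ((k : ℝ) * S.cpl P k) ^ 2)))) := by
  rw [hcpl, hcpl]

/-- One step: if the right side of (0.20) is positive at step k, then g_{k+1} > 0 and 1∕g_k² = 1∕g_{k+1}² + β_{k+1}(…, g_k).
[cite: Balaban1987RG1, (0.20) p.256] -/
theorem run_step_of_hcpl
    (hcpl : ∀ (P : B12.RunParams) (k : ℕ), S.cpl P k = Nat.rec (motive := fun _ => ℝ) P.g0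
      (fun k g => 1 / Real.sqrt (1 / g ^ 2 - (1 / 100 + 1 / 100 * ((k : ℝ) * g / (1 + ((k : ℝ) * g) ^ 2))))) k)
    (P : B12.RunParams) (k : ℕ)
    (h : 0 < 1 / (S.cpl P k) ^ 2 - (1 / 100 + 1 / 100 * ((k : ℝ) * S.cpl P k / (1 + ((k : ℝ) * S.cpl P k) ^ 2)))) :
    0 < S.cpl P (k + 1) ∧ 1 / (S.cpl P k) ^ 2 = 1 / (S.cpl P (k + 1)) ^ 2 +
      (1 / 100 + 1 / 100 * ((k : ℝ) * S.cpl P k / (1 + ((k : ℝ) * S.cpl P k) ^ 2))) := by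
  rw [run_succ_of_hcpl hcpl]
  refine ⟨one_div_pos.mpr (Real.sqrt_pos.mpr h), ?_⟩
  rw [div_pow, one_pow, Real.sq_sqrt h.le, one_div_one_div]
  ring

/-- **The run from g₀ with 1∕g₀² = 1 + (3∕200)(j + 2) stays positive with 1∕g_k² ≥ 1 + (3∕200)(j + 2 − k) for k ≤ j + 1** (each step
subtracts β_{k+1} ≤ 3∕200). [cite: Balaban1987RG1, (0.20) p.256] -/
theorem run_bound_of_hcpl
    (hcpl : ∀ (P : B12.RunParams) (k : ℕ), S.cpl P k = Nat.rec (motive := fun _ => ℝ) P.g0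
      (fun k g => 1 / Real.sqrt (1 / g ^ 2 - (1 / 100 + 1 / 100 * ((k : ℝ) * g / (1 + ((k : ℝ) * g) ^ 2))))) k)
    (j : ℕ) {g₀ : ℝ} (hg₀ : 0 < g₀) (h0 : 1 / g₀ ^ 2 = 1 + 3 / 200 * ((j : ℝ) + 2)) :
    ∀ k, k ≤ j + 1 → 0 < S.cpl ⟨j + 1, 0, g₀⟩ k ∧ 1 + 3 / 200 * ((j : ℝ) + 2 - k) ≤ 1 / (S.cpl ⟨j + 1, 0, g₀⟩ k) ^ 2 := by
  intro k
  induction k with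
  | zero =>
    intro _
    have e0 : S.cpl ⟨j + 1, 0, g₀⟩ 0 = g₀ := by rw [hcpl]; rfl
    rw [e0, h0]
    exact ⟨hg₀, by simp⟩
  | succ k ih =>
    intro hk
    obtain ⟨hpos, hb⟩ := ih (Nat.le_of_succ_le hk)
    have hF := (toyBeta_mem (k : ℝ) (S.cpl ⟨j + 1, 0, g₀⟩ k)).2
    have hkj : (k : ℝ) ≤ j := by exact_mod_cast Nat.le_of_lt_succ (Nat.lt_of_succ_le hk)
    have hrhs : 0 < 1 / (S.cpl ⟨j + 1, 0, g₀⟩ k) ^ 2 -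
        (1 / 100 + 1 / 100 * ((k : ℝ) * S.cpl ⟨j + 1, 0, g₀⟩ k / (1 + ((k : ℝ) * S.cpl ⟨j + 1, 0, g₀⟩ k) ^ 2))) := by
      nlinarith [hb, hF, hkj]
    obtain ⟨hpos', heq⟩ := run_step_of_hcpl hcpl ⟨j + 1, 0, g₀⟩ k hrhs
    refine ⟨hpos', ?_⟩
    push_cast
    linarith [heq, hb, hF]

/-- **Theorem 3's run hypothesis for the run (K, m, g₀) = (j + 1, 0, g₀(j))**, g₀(j) = (1 + (3∕200)(j + 2))^{−1∕2}: (0.20) holds along it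
(β at the run's own prefixes = the toy section at the last coupling) and 0 < g_k ≤ 1 = γ for k ≤ j + 1.  So for EVERY j the setting has a run
Theorem 3 speaks of that reaches step j + 1. [cite: Balaban1987RG1, Thm 3 p.264 with (0.20) p.256] -/
theorem runHyp_of_toy
    (hβ : ∀ (k : ℕ) (p : Fin (k + 1) → ℝ), S.β k p =
      1 / 100 + 1 / 100 * ((k : ℝ) * p (Fin.last k) / (1 + ((k : ℝ) * p (Fin.last k)) ^ 2)))
    (hcpl : ∀ (P : B12.RunParams) (k : ℕ), S.cpl P k = Nat.rec (motive := fun _ => ℝ) P.g0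
      (fun k g => 1 / Real.sqrt (1 / g ^ 2 - (1 / 100 + 1 / 100 * ((k : ℝ) * g / (1 + ((k : ℝ) * g) ^ 2))))) k)
    (hγ : S.γ = 1) (j : ℕ) : RunHyp S ⟨j + 1, 0, 1 / Real.sqrt (1 + 3 / 200 * ((j : ℝ) + 2))⟩ := by
  have hA : (0 : ℝ) < 1 + 3 / 200 * ((j : ℝ) + 2) := by positivity
  have hg₀ : (0 : ℝ) < 1 / Real.sqrt (1 + 3 / 200 * ((j : ℝ) + 2)) := by positivity
  have h0 : 1 / (1 / Real.sqrt (1 + 3 / 200 * ((j : ℝ) + 2))) ^ 2 = 1 + 3 / 200 * ((j : ℝ) + 2) := by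
    rw [div_pow, one_pow, Real.sq_sqrt hA.le, one_div_one_div]
  have hB := run_bound_of_hcpl hcpl j hg₀ h0
  refine ⟨fun k hk => ?_, fun k hk => ?_⟩
  · obtain ⟨_, hb⟩ := hB k hk.le
    have hF := (toyBeta_mem (k : ℝ) (S.cpl ⟨j + 1, 0, 1 / Real.sqrt (1 + 3 / 200 * ((j : ℝ) + 2))⟩ k)).2
    have hkj : (k : ℝ) ≤ j := by exact_mod_cast Nat.le_of_lt_succ hk
    have hrhs : 0 < 1 / (S.cpl ⟨j + 1, 0, 1 / Real.sqrt (1 + 3 / 200 * ((j : ℝ) + 2))⟩ k) ^ 2 -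
        (1 / 100 + 1 / 100 * ((k : ℝ) * S.cpl ⟨j + 1, 0, 1 / Real.sqrt (1 + 3 / 200 * ((j : ℝ) + 2))⟩ k /
          (1 + ((k : ℝ) * S.cpl ⟨j + 1, 0, 1 / Real.sqrt (1 + 3 / 200 * ((j : ℝ) + 2))⟩ k) ^ 2))) := by
      nlinarith [hb, hF, hkj]
    have hs := (run_step_of_hcpl hcpl _ k hrhs).2
    rw [hβ]
    simpa [prefixOf] using hs
  · obtain ⟨hpos, hb⟩ := hB k hk
    have hkj : (k : ℝ) ≤ j + 1 := by exact_mod_cast hk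
    have h1 : 1 ≤ 1 / (S.cpl ⟨j + 1, 0, 1 / Real.sqrt (1 + 3 / 200 * ((j : ℝ) + 2))⟩ k) ^ 2 := by nlinarith [hb, hkj]
    have hsq : (S.cpl ⟨j + 1, 0, 1 / Real.sqrt (1 + 3 / 200 * ((j : ℝ) + 2))⟩ k) ^ 2 ≤ 1 := by
      rwa [le_one_div one_pos (pow_pos hpos 2), div_one] at h1
    refine ⟨hpos, ?_⟩
    rw [hγ]
    nlinarith [hpos, hsq]

/-! ## §4 The toy setting and what it certifies -/

/-- **THE LAST-VARIABLE TOY**: L = 13, γ = 1, β_{k+1}(g₀, …, g_k) := 1∕100 + 1∕100·φ(k·g_k) with φ(t) = t∕(1 + t²) (one-loop part 1∕100 from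
log Z, interaction part 1∕100·φ(k·g_k) from 𝐄_int, vanishing at g_k = 0), Π_{k+1} := β_{k+1}·Re Qᵀ, pol F := F(1)·Re Qᵀ, (1.18)-slot
«|F(1)| ≤ E», E₀ = δ₁ = 1, C510 = MQ(1, 4), C544 = 3∕200, the p. 266 cut-off flag OFF, runs = forward solutions of (0.20).  It satisfies
`StandingHypotheses ∧ Definitions ∧ Conclusions`. [folklore] -/
theorem toyLastVar_exists : ∃ S : Setting,
    (∀ (k : ℕ) (p : Fin (k + 1) → ℝ), S.β k p =
      1 / 100 + 1 / 100 * ((k : ℝ) * p (Fin.last k) / (1 + ((k : ℝ) * p (Fin.last k)) ^ 2))) ∧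
    (∀ (P : B12.RunParams) (k : ℕ), S.cpl P k = Nat.rec (motive := fun _ => ℝ) P.g0
      (fun k g => 1 / Real.sqrt (1 / g ^ 2 - (1 / 100 + 1 / 100 * ((k : ℝ) * g / (1 + ((k : ℝ) * g) ^ 2))))) k) ∧
    S.γ = 1 ∧ ¬ S.altCutoff266 ∧ StandingHypotheses S ∧ Definitions S ∧ Conclusions S := by
  -- `Setting` fields in order: L, groupScope, ε₀, cpl, β, γ, M, κ, Cfg, one, logZ, Eint, Ebold, repr437, α₀, α₁, E₀, Mκ, pol, polIV, κ₀,
  -- indAss, ε₁, altCutoff266, logN2, δ₀, δ₁, C510, C544 (anonymous constructor).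
  refine ⟨⟨13, True, 1,
      fun P k => Nat.rec (motive := fun _ => ℝ) P.g0
        (fun k g => 1 / Real.sqrt (1 / g ^ 2 - (1 / 100 + 1 / 100 * ((k : ℝ) * g / (1 + ((k : ℝ) * g) ^ 2))))) k,
      fun k p => 1 / 100 + 1 / 100 * ((k : ℝ) * p (Fin.last k) / (1 + ((k : ℝ) * p (Fin.last k)) ^ 2)), 1, 1, 1,
      fun _ => Unit, fun _ => (), fun _ _ => 1 / 100,
      fun k p _ => 1 / 100 * ((k : ℝ) * p (Fin.last k) / (1 + ((k : ℝ) * p (Fin.last k)) ^ 2)),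
      fun k p _ => 1 / 100 + 1 / 100 * ((k : ℝ) * p (Fin.last k) / (1 + ((k : ℝ) * p (Fin.last k)) ^ 2)),
      fun _ F E => |F ()| ≤ E, 1, 1, 1, fun _ => 1, fun _ F => fun μ ν x => F () * (wilsonQ ν μ x).re,
      fun k p => fun μ ν x =>
        (1 / 100 + 1 / 100 * ((k : ℝ) * p (Fin.last k) / (1 + ((k : ℝ) * p (Fin.last k)) ^ 2))) * (wilsonQ ν μ x).re,
      1, fun _ _ => True, 1, False,
      fun k p => 1 / 100 * ((k : ℝ) * p (Fin.last k) / (1 + ((k : ℝ) * p (Fin.last k)) ^ 2)), 1, 1, MQ 1 4, 3 / 200⟩,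
    fun _ _ => rfl, fun _ _ => rfl, rfl, fun h => h, ?_, ?_, ?_⟩
  · exact { hL := ⟨by decide, by norm_num⟩, hG := trivial, hκ₀ := by norm_num, hMκ := by norm_num, hγ := by norm_num,
            hε₀ := by norm_num, hε₁ := by norm_num, hα₀ := by norm_num, hα₁ := by norm_num, hκ := by norm_num,
            hM := by norm_num }
  · refine { d018 := fun P => rfl, d020 := ?_, d13 := ?_, d213 := ?_, d214 := ?_, d120 := ?_, d120split := ?_,
             d121 := ?_, d122 := ?_ }
    · intro P k _ _ hrhs
      exact natRec_run_step P.g0 (fun k g => 1 / 100 + 1 / 100 * ((k : ℝ) * g / (1 + ((k : ℝ) * g) ^ 2))) k hrhs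
    · intro j p U; simp
    · intro k p p' hp hp'
      show (fun _ : Unit => (1 / 100 : ℝ) * ((k : ℝ) * p (Fin.last k) / (1 + ((k : ℝ) * p (Fin.last k)) ^ 2))) =
        fun _ : Unit => (1 / 100 : ℝ) * ((k : ℝ) * p' (Fin.last k) / (1 + ((k : ℝ) * p' (Fin.last k)) ^ 2))
      rw [hp, hp']
    · intro k p; rfl
    · intro j p; rfl
    · intro j p; funext μ ν x; simp only [Pi.add_apply]; ring
    · intro k p
      refine ⟨fun σ μ ν x => congrArg (fun r : ℝ => (1 / 100 + 1 / 100 * ((k : ℝ) * p (Fin.last k) /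
          (1 + ((k : ℝ) * p (Fin.last k)) ^ 2))) * r) (congrArg Complex.re (wilsonQ_perm σ ν μ x)),
        fun ε hε μ ν z => reflect_toyKernel _ hε μ ν z,
        fun μ ν z => congrArg (fun r : ℝ => (1 / 100 + 1 / 100 * ((k : ℝ) * p (Fin.last k) /
          (1 + ((k : ℝ) * p (Fin.last k)) ^ 2))) * r) (congrArg Complex.re (wilsonQ_neg_transpose ν μ z).symm)⟩
    · intro j p _ μ ν hμν
      exact ⟨(fourier_toyKernel hμν _).symm, (secondMoment_toyKernel hμν _).symm⟩
  · refine { c13 := fun _ _ _ _ => trivial, c118 := fun _ _ j _ s _ => ⟨?_, ?_⟩, c264 := ?_, c510 := ?_, c537 := ?_ }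
    · exact ((abs_toyBeta_le _ _).1).trans (by norm_num)
    · exact ((abs_toyBeta_le _ _).2).trans (by norm_num)
    · exact c264_of_toyBeta (fun _ _ => rfl) rfl (fun h => h)
    · refine ⟨by norm_num, fun j F E hF μ ν x => ?_⟩
      have hF' : |F ()| ≤ E := hF
      have hd := decay510_toyKernel (d := 4) (F ()) μ ν x
      have hMQ := B12Rep537.MQ_nonneg 1 4
      show |F () * (wilsonQ ν μ x).re| ≤ MQ 1 4 * E * Real.exp (-1 * B12Sec2to5.l1 x)
      calc |F () * (wilsonQ ν μ x).re| ≤ |F ()| * MQ 1 4 * Real.exp (-1 * B12Sec2to5.l1 x) := hd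
        _ ≤ E * MQ 1 4 * Real.exp (-1 * B12Sec2to5.l1 x) := by gcongr
        _ = MQ 1 4 * E * Real.exp (-1 * B12Sec2to5.l1 x) := by ring
    · intro P _ j _ s _ μ ν
      by_cases hμν : μ = ν
      · subst hμν
        exact ⟨fun _ _ => 0, fun x => rep537_diag _ μ x, fun w => expBound_zero _ _ (by norm_num)⟩
      · obtain ⟨rem, hrep, hdec⟩ := rep537_toyKernel (d := 4) hμν
          (1 / 100 + 1 / 100 * ((j : ℝ) * sectionHist _ P j s (Fin.last j) / (1 + ((j : ℝ) * sectionHist _ P j s (Fin.last j)) ^ 2)))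
          (1 / 2)
        exact ⟨rem, hrep, fun w => (hdec w).mono (((abs_toyBeta_le _ _).1).trans (by norm_num))⟩

/-- **[I] AS PRINTED IS CONSISTENT WITH THE FAILURE OF EVERY k-UNIFORM LAST-VARIABLE LETTER** (row I1's necessity witness at the level of
the as-printed interface).  There is a setting with `StandingHypotheses ∧ Definitions ∧ Conclusions` — hence `B12BetaAsPrinted S` —, with
the box-wide PER-STEP schemata `BetaSmoothInLast264` and `BetaDerivsBoundedInLast264` of `B12CouplingClausesHistory` (the history-explicit
readings of p. 264's clause with step-dependent bounds), with runs Theorem 3 speaks of reaching EVERY depth, and yet: NO constant C makes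
`BetaDerivClause.LastVarLipschitz S.β C γ` true, NO constant makes `LastVarLipschitzAtZero S.β C γ` ((AF-1)) true, and NO Lipschitz constant in
the last variable is uniform along the runs Theorem 3 speaks of.  The k-uniformity that row I1 ∕ row an4 locate OUTSIDE print is thus not a
consequence of the printed content as typed (the derivative of β_{k+1} at g_k = 0 is k∕100 in the toy). [cite: Balaban1987RG1, p.264 (β-clause after (1.22)) with Thm 3 p.264] -/
theorem asPrinted_consistent_with_nonuniform_lastVar :
    ∃ S : Setting, ∃ _hH : StandingHypotheses S, Definitions S ∧ Conclusions S ∧ B12BetaAsPrinted S ∧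
      BetaSmoothInLast264 S.γ S.β ∧ BetaDerivsBoundedInLast264 S.γ S.β ∧
      (∀ j : ℕ, ∃ P : B12.RunParams, RunHyp S P ∧ P.K = j + 1) ∧
      (∀ C : ℝ, ¬ LastVarLipschitz S.β C S.γ) ∧ (∀ C : ℝ, ¬ LastVarLipschitzAtZero S.β C S.γ) ∧
      ¬ ∃ C : NNReal, ∀ (P : B12.RunParams) (j : ℕ), RunHyp S P → j + 1 ≤ P.K →
        LipschitzOnWith C (lastSection S P j) (Set.Icc 0 S.γ) := by
  obtain ⟨S, hβ, hcpl, hγ, halt, hH, hD, hC⟩ := toyLastVar_exists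
  have hruns : ∀ j : ℕ, ∃ P : B12.RunParams, RunHyp S P ∧ P.K = j + 1 :=
    fun j => ⟨⟨j + 1, 0, 1 / Real.sqrt (1 + 3 / 200 * ((j : ℝ) + 2))⟩, runHyp_of_toy hβ hcpl hγ j, rfl⟩
  exact ⟨S, hH, hD, hC, fun _ _ => hC, betaSmoothInLast264_of_toyBeta hβ, betaDerivsBoundedInLast264_of_toyBeta hβ hγ, hruns,
    not_lastVarLipschitz_of_toyBeta hβ hγ, not_lastVarLipschitzAtZero_of_toyBeta hβ hγ, not_uniform_lipschitz_of_toyBeta hβ hγ hruns⟩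

/-- **THE k-UNIFORM LAST-VARIABLE CLAUSE IS INDEPENDENT OF [I]'S PRINTED CONTENT, AS TYPED**: the last-variable toy satisfies the
as-printed antecedents without ANY `LastVarLipschitz` constant; the AF toy of `…B12AsPrintedWitness` (β constant) satisfies them with the
constant 0. [cite: Balaban1987RG1, p.264 (β-clause after (1.22))] -/
theorem lastVarLipschitz_independent_of_asPrinted :
    (¬ ∀ (S : Setting) (_hH : StandingHypotheses S), Definitions S → Conclusions S → ∃ C : ℝ, LastVarLipschitz S.β C S.γ) ∧
    (¬ ∀ (S : Setting) (_hH : StandingHypotheses S), Definitions S → Conclusions S → ∀ C : ℝ, ¬ LastVarLipschitz S.β C S.γ) := by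
  constructor
  · intro h
    obtain ⟨S, hH, hD, hC, -, -, -, -, hno, -⟩ := asPrinted_consistent_with_nonuniform_lastVar
    obtain ⟨C, hCL⟩ := h S hH hD hC
    exact hno C hCL
  · intro h
    obtain ⟨S, hβ, -, hH, hD, hC, -⟩ := afToy_exists
    refine h S hH hD hC 0 fun k p _ s t _ _ => ?_
    rw [hβ, hβ, sub_self, abs_zero, zero_mul]

end

end Summit.QuantumFields.BalabanUV.Beta.EriceFlowEnclosureB12AsPrintedLastVarEnd
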